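import Summits.BirchSwinnertonDyer.Rank1Residual.P2.CMKolyvaginHabitatInertAtlas
import HarnessLib

/-!
# Crux `InertOddHeegnerJOfFacts` (stmt-BirchSwinnertonDyer-20672, leaf `WAllCornerFTwo`): the
# TAMAGAWA INDEX `t = v₂(∏ c_ℓ)` on the five odd-Heegner twist families, DECIDED — `t = 1 ⟺ d` is
# `q`-silent

Cell `bsd-print-cf2`, seat ty2 (discharge interface), helper for crux stmt-BirchSwinnertonDyer-20672
(route `PrintCf2`; idea card `tamagawa-shifted-kolyvagin` of the cell planner, 2026-08-28). HONEST
FRAMING: THEOREMS ONLY — no definition, no named fact, no route file imported, nothing about BSD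
asserted or booked; the leaf and the crux are OPEN; BSD is not proved by any of this.

The consequent of 20672 is, in model currency (`CornerFTwo.oddHeegnerJ_iff_twists`), `BSD(W, 2)` for
every globally minimal model `W` of analytic rank one of a square-free twist `cm_q^{(d)}` of one of the
five odd-inert CM bases `cm11 = 121b1`, `cm19 = 361a1`, `cm43 = 1849a1`, `cm67 = 4489a1`,
`cm163 = 26569a1` (`cm_q = (0, a₂, 1, a₄, a₆)`, `Δ(cm_q) = −q³`, `j = j(A(q))`). Every such curve is
OFF the habitat `H₂` of route `CMKolyvaginAtInertTwo` for exactly one reason: `c_q = 2`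
(`InertAtlas.localTamagawaNumber_eq_two_of_j_oddHeegner`), so the Tamagawa product is even. The
Tamagawa-shifted Kolyvagin line replaces the binder `Odd ∏ c_ℓ` by the INDEX
`t := v₂(∏_ℓ c_ℓ(W))` (W. Zhang's `𝓜_∞`; Jetchev 2008 Cor. 1.5 is exact when a single Tamagawa
number is even, i.e. on the sub-class `t = 1`). This file decides `t` on the five families:

* §1 `padicValNat_two_finprod_eq_one_iff`, `padicValNat_two_tamagawaProduct_eq_one_iff_of_eq_two` —
  assembly: if one local factor is `2`, then `v₂(∏ᶠ c_v) = 1` iff every OTHER factor is odd;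
  `one_le_padicValNat_two_tamagawaProduct_of_eq_two` — and `t ≥ 1`.
* §2 `padicValNat_two_tamagawaProduct_twist_eq_one_iff` — THE GENERIC CRITERION: for a globally
  minimal base `B = (0, a₂, 1, a₄, a₆)` with `Δ = −q³` (`q` an odd prime), `d ≠ 0` square-free and
  EVERY model `W'` of `B^{(d)}` whose place over `q` is of type `III`/`III*`:
  **`v₂(∏ c_ℓ(W')) = 1 ⟺` for every prime `p ∣ d` with `p ∤ 2q`, the `2`-division cubic
  `4x³ + 4a₂x² + 4a₄x + 4a₆ + 1` of `B` has no root mod `p`** (`d` is `q`-SILENT). Mechanism =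
  Boxer–Diao 2010, proof of Prop. 4.1, run in the tree on the integer twist model
  `J = (0, 4da₂, 0, 16d²a₄, 16d³(4a₆+1))` (`BoxerDiao2010/TamagawaTwistHolds`): `c₂ = 1` (`4 ∤ d`);
  `c_p = 1` at odd `p ∤ qd`; at odd `p ∣ d`, `p ≠ q`: type `I₀*`, `c_p = 1` without a root of the
  cubic mod `p`, `2 ∣ c_p` with one; and `c_q = 2` (type `III`/`III*`).
* the companion file `CMKolyvaginTamagawaIndexOddHeegnerBases.lean` instantiates §2 on the five bases
  (`…_twist_cm11_eq_one_iff` with cubic `4x³ − 4x² − 28x + 41`, …, `…_cm163_…` with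
  `4x³ − 8697680x + 4936546769`), proves `t ≥ 1` on every model of every twist and `t = 1` for the
  five untwisted bases.

So the `t = max = 1` sub-class of 20672 named by the card (the bases and their twists by `d` all of
whose odd prime factors `p ≠ q` keep `cm_q mod p` free of `2`-torsion) is an explicit decidable
predicate on `(q, d)`; its complement inside 20672 has `t ≥ 2`.

Numerical cross-check (EVIDENCE, not used): kit j297287 (PARI, all square-free `|d| ≤ 2000`, `12150`
twists of the five bases): `t = 1 ⟺ d` `q`-silent in `12150/12150`, `c_q = 2` in `12150/12150`.

References: G. Boxer–P. Diao, Proc. AMS 138 (2010), proof of Prop. 4.1 (pp. 1976–1977) [BoxerDiao2010];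
Silverman *ATAEC* IV.9.4 (Tate's algorithm, Steps 4, 6, 9; Table 4.1), App. A §3 [SilvermanATAEC1994];
Silverman *AEC* VII.1, VII.6, X.5 Prop. 5.4 [SilvermanAEC2009]; Cremona's tables (121b1, 361a1,
1849a1, 4489a1, 26569a1) [Cremona1997]; D. Jetchev, *Global divisibility of Heegner points and
Tamagawa numbers*, Compos. Math. 144 (2008) Thm. 1.4, Cor. 1.5 [Jetchev2008]; B. Gross, LNM 776 (1980)
§§22–24 (the curves `A(q)`).
-/

set_option autoImplicit false

noncomputable section

open scoped Classical NumberField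

open WeierstrassCurve NumberField IsDedekindDomain IsDedekindDomain.HeightOneSpectrum Rat.HeightOneSpectrum
  Literature.NumberTheory.EllipticCurves Literature.NumberTheory.EllipticCurves.BoxerDiao2010
  Literature.NumberTheory.EllipticCurves.Rank1Residual
  Literature.NumberTheory.EllipticCurves.Rank1Residual.X11RankOneCertificates
  Summit.BirchSwinnertonDyer.Rank1Residual Summit.BirchSwinnertonDyer.Rank1Residual.P2

namespace Summit.BirchSwinnertonDyer.Rank1Residual.P2.OddHeegnerTwists

/-! ## §1 Assembly: one factor `2`, the rest odd -/

/-- If `f i₀ = 2` in a finitely supported family of naturals, then `v₂(∏ᶠ f) = 1` iff every other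
factor is odd. [folklore] -/
theorem padicValNat_two_finprod_eq_one_iff {ι : Type*} (f : ι → ℕ) (hf : (Function.mulSupport f).Finite)
    {i₀ : ι} (h0 : f i₀ = 2) :
    padicValNat 2 (∏ᶠ i, f i) = 1 ↔ ∀ i, i ≠ i₀ → Odd (f i) := by
  have hmem : i₀ ∈ hf.toFinset := by
    rw [Set.Finite.mem_toFinset, Function.mem_mulSupport, h0]; decide
  rw [finprod_eq_prod f hf, ← Finset.mul_prod_erase _ _ hmem, h0]
  set R := ∏ i ∈ hf.toFinset.erase i₀, f i with hR
  constructor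
  · intro h i hi
    by_contra hodd
    have h2 : 2 ∣ f i := even_iff_two_dvd.mp (Nat.not_odd_iff_even.mp hodd)
    have hiS : i ∈ hf.toFinset.erase i₀ := by
      rw [Finset.mem_erase, Set.Finite.mem_toFinset, Function.mem_mulSupport]
      refine ⟨hi, fun h1 => ?_⟩
      rw [h1] at h2
      exact absurd h2 (by decide)
    have hR2 : 2 ∣ R := h2.trans (Finset.dvd_prod_of_mem f hiS)
    have hne : 2 * R ≠ 0 := fun h0' => by rw [h0', padicValNat_zero_right] at h; exact zero_ne_one h
    have h4 : 2 ^ 2 ∣ 2 * R := by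
      obtain ⟨r, hr⟩ := hR2
      exact ⟨r, by rw [hr]; ring⟩
    have hle := (padicValNat_dvd_iff_le hne).mp h4
    omega
  · intro h
    have hRodd : Odd R :=
      Finset.prod_induction f Odd (fun a b ha hb => ha.mul hb) odd_one
        fun i hi => h i (Finset.mem_erase.mp hi).1
    have hRne : R ≠ 0 := fun h0' => by rw [h0'] at hRodd; exact absurd hRodd (by decide)
    rw [padicValNat.mul (by norm_num) hRne, padicValNat_self,
      padicValNat.eq_zero_of_not_dvd fun h2 => (Nat.not_even_iff_odd.mpr hRodd) (even_iff_two_dvd.mpr h2)]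

/-- A factor `2` makes `2` divide the finite product. [folklore] -/
theorem two_dvd_finprod_of_eq_two {ι : Type*} (f : ι → ℕ) (hf : (Function.mulSupport f).Finite)
    {i₀ : ι} (h0 : f i₀ = 2) : 2 ∣ ∏ᶠ i, f i := by
  rw [← h0]
  exact finprod_mem_dvd i₀ hf

variable (W : WeierstrassCurve ℚ) [W.IsElliptic]

/-- **`v₂(∏_v c_v) = 1 ⟺` every local Tamagawa number off a given place `v₀` with `c_{v₀} = 2` is
odd** (`∏_v c_v = ∏ᶠ_v c_v`, `c_v = 1` off the bad places). [cite: SilvermanAEC2009, Prop. VII.5.1 (a) with §VII.2] -/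
theorem padicValNat_two_tamagawaProduct_eq_one_iff_of_eq_two (v₀ : HeightOneSpectrum (𝓞 ℚ))
    (h0 : (W.baseChange (v₀.adicCompletion ℚ)).localTamagawaNumber (v₀.adicCompletionIntegers ℚ) = 2) :
    padicValNat 2 W.tamagawaProduct = 1 ↔
      ∀ v : HeightOneSpectrum (𝓞 ℚ), v ≠ v₀ →
        Odd ((W.baseChange (v.adicCompletion ℚ)).localTamagawaNumber (v.adicCompletionIntegers ℚ)) :=
  padicValNat_two_finprod_eq_one_iff _ W.mulSupport_localTamagawaNumber_finite_holds h0

/-- **A place with `c_{v₀} = 2` gives `t = v₂(∏_v c_v) ≥ 1`.** [cite: SilvermanAEC2009, Prop. VII.5.1 (a) with §VII.2] -/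
theorem one_le_padicValNat_two_tamagawaProduct_of_eq_two (v₀ : HeightOneSpectrum (𝓞 ℚ))
    (h0 : (W.baseChange (v₀.adicCompletion ℚ)).localTamagawaNumber (v₀.adicCompletionIntegers ℚ) = 2) :
    1 ≤ padicValNat 2 W.tamagawaProduct := by
  have h2 : 2 ^ 1 ∣ W.tamagawaProduct := by
    rw [pow_one]
    exact two_dvd_finprod_of_eq_two _ W.mulSupport_localTamagawaNumber_finite_holds h0
  exact (padicValNat_dvd_iff_le W.tamagawaProduct_pos_holds.ne').mp h2

/-- **`t ≥ 1` on rows (d)–(h):** every curve over `ℚ` with one of the five odd-Heegner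
`j`-invariants has `2 ∣ ∏ c_ℓ`, i.e. `1 ≤ v₂(∏ c_ℓ)` (`c_q = 2` at the CM prime).
[cite: SilvermanATAEC1994, IV.9.4 Steps 4 and 9 and Table 4.1] [cite: Cremona1997, Table 1] -/
theorem one_le_padicValNat_two_tamagawaProduct_of_j_oddHeegner
    (hj : W.j = -32768 ∨ W.j = -884736 ∨ W.j = -884736000 ∨ W.j = -147197952000 ∨
      W.j = -262537412640768000) : 1 ≤ padicValNat 2 W.tamagawaProduct := by
  obtain ⟨v, hv⟩ := InertAtlas.localTamagawaNumber_eq_two_of_j_oddHeegner W hj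
  exact one_le_padicValNat_two_tamagawaProduct_of_eq_two W v hv

/-! ## §2 The generic criterion on a base `(0, a₂, 1, a₄, a₆)` with `Δ = −q³` -/

/-- Distinct finite places of `ℚ` lie over distinct primes. [folklore] -/
theorem natGenerator_injective : Function.Injective (natGenerator (R := 𝓞 ℚ)) :=
  fun _ _ h => (primesEquiv (R := 𝓞 ℚ)).injective (Subtype.ext h)

/-- `q¹² ∤ −p³` for primes `p`, `q` (so a model with `Δ = −p³` passes the minimality criterion).
[cite: SilvermanAEC2009, VII.1 Remark 1.1] -/
theorem not_pow_twelve_dvd_neg_prime_cube {p q : ℕ} (hp : p.Prime) (hq : q.Prime) :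
    ¬ (q : ℤ) ^ 12 ∣ -(p : ℤ) ^ 3 := by
  intro h
  rw [dvd_neg] at h
  have hq' : Prime (q : ℤ) := Nat.prime_iff_prime_int.mp hq
  have hqp : (q : ℤ) ∣ (p : ℤ) := hq'.dvd_of_dvd_pow (dvd_trans (dvd_pow_self _ (by norm_num)) h)
  have hqp' : q ∣ p := by exact_mod_cast hqp
  have heq : q = p := (Nat.prime_dvd_prime_iff_eq hq hp).mp hqp'
  subst heq
  have h' : q ^ 12 ∣ q ^ 3 := by exact_mod_cast h
  have := (Nat.pow_dvd_pow_iff_le_right hq.one_lt).mp h'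
  omega

section Generic

variable {B : WeierstrassCurve ℚ} [B.IsElliptic] [B.IsGloballyMinimal] {a2 a4 a6 : ℤ} {q : ℕ}
  (W' : WeierstrassCurve ℚ) [W'.IsElliptic] {C : VariableChange ℚ} {d : ℤ}

/-- **THE TAMAGAWA INDEX CRITERION ON A TWIST FAMILY WITH ONE CM PRIME.** Let `B = (0, a₂, 1, a₄, a₆)`
be globally minimal with integer model `M = (0, a₂, 1, a₄, a₆)`, `Δ(M) = −q³`, `q` prime; let
`d ≠ 0` be square-free and `W'` ANY model of `B^{(d)}` whose place over `q` is of Kodaira type `III`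
or `III*`. Then **`v₂(∏_ℓ c_ℓ(W')) = 1 ⟺` for every prime `p ∣ d`, `p ∤ 2q`, the cubic
`4x³ + 4a₂x² + 4a₄x + 4a₆ + 1` has no root mod `p`.** Boxer–Diao's proof of Prop. 4.1 in the
kernel: `c₂ = 1`; `c_p = 1` at odd `p ∤ qd`; at odd `p ∣ d`, `p ≠ q`: `I₀*`, `c_p = 1` without a
root, even with one; `c_q = 2`. [cite: BoxerDiao2010, proof of Prop. 4.1 (pp. 1976–1977)]
[cite: SilvermanATAEC1994, IV.9.4 Steps 4, 6, 9 and Table 4.1] -/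
theorem padicValNat_two_tamagawaProduct_twist_eq_one_iff (h1 : B.a₁ = 0) (h3 : B.a₃ = 1)
    (hM : integralModelInt B = ⟨0, a2, 1, a4, a6⟩) (hq : q.Prime)
    (hΔ : (⟨0, a2, 1, a4, a6⟩ : WeierstrassCurve ℤ).Δ = -(q : ℤ) ^ 3)
    (hd0 : d ≠ 0) (hsq : Squarefree d) (hC : C • W' = B.quadraticTwist (d : ℚ))
    (hKq : ∀ v : HeightOneSpectrum (𝓞 ℚ), natGenerator v = q →
      W'.kodairaSymbolAt v = .III ∨ W'.kodairaSymbolAt v = .IIIstar) :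
    padicValNat 2 W'.tamagawaProduct = 1 ↔
      ∀ p : ℕ, p.Prime → p ≠ 2 → p ≠ q → (p : ℤ) ∣ d →
        ∀ x : ZMod p, 4 * x ^ 3 + 4 * (a2 : ZMod p) * x ^ 2 + 4 * (a4 : ZMod p) * x +
          (4 * (a6 : ZMod p) + 1) ≠ 0 := by
  set M : WeierstrassCurve ℤ := integralModelInt B with hMdef
  have hM1 : M.a₁ = 0 := by rw [hM]
  have hM3 : M.a₃ = 1 := by rw [hM]
  have hMΔ : M.Δ = -(q : ℤ) ^ 3 := by rw [hM]; exact hΔ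
  set J : WeierstrassCurve ℤ := ⟨0, 4 * d * M.a₂, 0, 16 * d ^ 2 * M.a₄,
    16 * d ^ 3 * (4 * M.a₆ + 1)⟩ with hJ
  -- `c_p(W') = c_p(J)` at every prime, `c₂ = 1`
  have key : ∀ (p : ℕ) [Fact p.Prime], (W'.baseChange ℚ_[p]).localTamagawaNumber ℤ_[p] =
      ((J.map (Int.castRingHom ℤ_[p])).baseChange ℚ_[p]).localTamagawaNumber ℤ_[p] :=
    fun p _ => localTamagawaNumber_padic_eq_twistIntModel _ h1 h3 hd0 W' C hC p
  have hd4 : ¬ (4 : ℤ) ∣ d := fun ⟨e, he⟩ => by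
    have hunit : IsUnit (2 : ℤ) := hsq 2 ⟨e, by rw [he]; ring⟩
    rcases Int.isUnit_iff.mp hunit with h | h <;> omega
  have key2 : (W'.baseChange ℚ_[2]).localTamagawaNumber ℤ_[2] = 1 :=
    localTamagawaNumber_two_eq_one _ h1 h3 hd0 W' C hC hd4
  -- `p ∤ Δ(M) = −q³` for `p ≠ q`
  have hpΔ : ∀ p : ℕ, p.Prime → p ≠ q → ¬ (p : ℤ) ∣ M.Δ := fun p hp hpq h => by
    rw [hMΔ, dvd_neg] at h
    have h' : (p : ℤ) ∣ (q : ℤ) := (Nat.prime_iff_prime_int.mp hp).dvd_of_dvd_pow h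
    exact hpq ((Nat.prime_dvd_prime_iff_eq hp hq).mp (by exact_mod_cast h'))
  -- the cubic of the integer twist model is `B`'s `2`-division cubic
  have hcub : ∀ (p : ℕ) (x : ZMod p), 4 * x ^ 3 + 4 * (M.a₂ : ZMod p) * x ^ 2 +
      4 * (M.a₄ : ZMod p) * x + (4 * (M.a₆ : ZMod p) + 1) =
        4 * x ^ 3 + 4 * (a2 : ZMod p) * x ^ 2 + 4 * (a4 : ZMod p) * x + (4 * (a6 : ZMod p) + 1) := by
    intro p x
    rw [hM]
  -- the place over `q`: `c_q = 2`
  obtain ⟨vq, hvq⟩ := Mordell.exists_place_natGenerator_eq hq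
  have hcq : (W'.baseChange (vq.adicCompletion ℚ)).localTamagawaNumber (vq.adicCompletionIntegers ℚ) = 2 :=
    InertAtlas.localTamagawaNumber_eq_two_of_III_or_IIIstar W' vq (hKq vq hvq)
  rw [padicValNat_two_tamagawaProduct_eq_one_iff_of_eq_two W' vq hcq]
  constructor
  · -- `t = 1` forces silence at every odd `p ≠ q` dividing `d`
    intro hodd p hp hp2 hpq hpd x hx
    haveI : Fact p.Prime := ⟨hp⟩
    obtain ⟨v, hv⟩ := Mordell.exists_place_natGenerator_eq hp
    have hvne : v ≠ vq := fun h => hpq (by rw [← hv, h, hvq])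
    obtain ⟨d₁, hd₁, hpd₁⟩ := TwentySevenA4.exists_eq_mul_not_dvd_of_squarefree hsq hp hpd
    have h2c : 2 ∣ (W'.baseChange (v.adicCompletion ℚ)).localTamagawaNumber
        (v.adicCompletionIntegers ℚ) := by
      rw [← WeierstrassCurve.localTamagawaNumber_padic_eq_holds W' v p hv, key p]
      exact two_dvd_localTamagawaNumber_twistIntModel_of_dvd_of_root p M hM1 hM3 d J hJ hd₁
        hp2 hpd₁ (hpΔ p hp hpq) ⟨x, by rw [hcub]; exact hx⟩
    exact (Nat.not_even_iff_odd.mpr (hodd v hvne)) (even_iff_two_dvd.mpr h2c)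
  · -- silence makes every local factor off `q` odd
    intro hsil v hvne
    have hp := prime_natGenerator v
    by_cases hv2 : natGenerator v = 2
    · haveI : Fact (Nat.Prime 2) := ⟨Nat.prime_two⟩
      rw [← WeierstrassCurve.localTamagawaNumber_padic_eq_holds W' v 2 hv2, key2]
      exact odd_one
    · haveI : Fact (Nat.Prime (natGenerator v)) := ⟨hp⟩
      have hvq' : natGenerator v ≠ q := fun h => hvne (natGenerator_injective (h.trans hvq.symm))
      rw [← WeierstrassCurve.localTamagawaNumber_padic_eq_holds W' v (natGenerator v) rfl,
        key (natGenerator v)]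
      by_cases hpd : (natGenerator v : ℤ) ∣ d
      · obtain ⟨d₁, hd₁, hpd₁⟩ :=
          TwentySevenA4.exists_eq_mul_not_dvd_of_squarefree hsq hp hpd
        rw [localTamagawaNumber_twistIntModel_eq_one_of_dvd_of_no_root (natGenerator v) M hM1 hM3 d
          J hJ hd₁ hv2 hpd₁ (hpΔ _ hp hvq') fun x hx => ?_]
        · exact odd_one
        exact hsil _ hp hv2 hvq' hpd x (by rw [← hcub]; exact hx)
      · rw [localTamagawaNumber_twistIntModel_eq_one_of_not_dvd (natGenerator v) M hM1 hM3 d J hJ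
          hv2 hpd (hpΔ _ hp hvq')]
        exact odd_one

/-- **`t ≥ 1` on every model of every twist** of a base whose twists keep type `III`/`III*` over `q`.
[cite: SilvermanATAEC1994, IV.9.4 Steps 4 and 9 and Table 4.1] -/
theorem one_le_padicValNat_two_tamagawaProduct_of_kodaira (hq : q.Prime)
    (hKq : ∀ v : HeightOneSpectrum (𝓞 ℚ), natGenerator v = q →
      W'.kodairaSymbolAt v = .III ∨ W'.kodairaSymbolAt v = .IIIstar) :
    1 ≤ padicValNat 2 W'.tamagawaProduct := by
  obtain ⟨vq, hvq⟩ := Mordell.exists_place_natGenerator_eq hq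
  exact one_le_padicValNat_two_tamagawaProduct_of_eq_two W' vq
    (InertAtlas.localTamagawaNumber_eq_two_of_III_or_IIIstar W' vq (hKq vq hvq))

end Generic

end Summit.BirchSwinnertonDyer.Rank1Residual.P2.OddHeegnerTwists

end
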